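import Summits.Ventures.AbcSig.Conjectures.LevelRaising32
import Literature.NumberTheory.EllipticCurves.HasseElementary

/-!
# Venture AbcSig — the arithmetic hypothesis of `CONJ_LR32_L1_of_exists`, DISCHARGED: `a_q(32a) ∈ bs04Allowed q`

HONEST FRAMING. Support file of the computation cell `pub-abcsig` for its TYPED conjecture `CONJ_LR32_L1`
(`Conjectures/LevelRaising32.lean`); it proves an unconditional ARITHMETIC fact about the elliptic curve
`32a : y² = x³ − x` and draws the consequence for the typed declaration. Nothing here is a claim on ABC or any
summit, and nothing is proved about the conjecture itself.

WHAT IS PROVED.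
* `a32_eq_trace` — the cell's naive point count `a32 q = q − Σ_{x mod q} #{y : y² ≡ x³ − x}` IS the trace
  `q + 1 − #E(𝔽_q)` of the short Weierstrass curve `⟨0, 0, 0, −1, 0⟩` over `ZMod q` (Mathlib's type of points,
  counted with the point at infinity), for every odd prime `q`.
* `a32_sq_le` — HASSE'S BOUND `a32(q)² ≤ 4q` for odd primes `q`, from the tree's sorry-free elementary (Manin/Knapp)
  proof `Literature.NumberTheory.EllipticCurves.HasseElementary.trace_sq_le`.
* `a32_even` — `a32(q)` is even for odd primes `q` (the cubic `x³ − x` has exactly the three roots `0, ±1`, every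
  other fibre has `0` or `2` points; equivalently: full rational `2`-torsion).
* `a32_mem_bs04Allowed` — hence `a32 q ∈ bs04Allowed q` ([BS04, Lemma 4.2]'s coarse set) for EVERY odd prime `q`:
  the hypothesis `hA` of `CONJ_LR32_L1_of_exists`, which `Conjectures/LevelRaising32.lean` could only check by
  `decide` for `q < 60`.
* `CONJ_LR32_L1_iff_exists` — consequently the typed conjecture `CONJ_LR32_L1 M` is EQUIVALENT, for every model
  `M`, to its pure level-raising existence clause (referee ref-g35's reading R2, now unconditional): the conjunct
  `M.ArisesMod f n bs04Allowed` carries no content beyond `CongruentTo M f n a32`.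

References: [BS04] Bennett–Skinner, Canad. J. Math. 56 (2004), Lemma 4.2; Hasse's theorem via A. W. Knapp,
*Elliptic Curves* (1992) §X.3 (the tree's `HasseElementary`); cell records HOME/lead/CONJ-LEAN-SPEC.md (R1/R2),
HOME/referee/lr32-l1-g35/.
-/

namespace Summit.Ventures.AbcSig.Conjectures

open Summit.Ventures.AbcSig
open Literature.NumberTheory.EllipticCurves

/-! ## The curve `32a` over `ZMod q` -/

/-- `32a : y² = x³ − x` as a short Weierstrass equation over `ZMod q`. -/
def curve32a (q : ℕ) : WeierstrassCurve (ZMod q) := ⟨0, 0, 0, -1, 0⟩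

/-- `curve32a q` is in short normal form (`a₁ = a₂ = a₃ = 0`). -/
instance curve32a_isShortNF (q : ℕ) : (curve32a q).IsShortNF := ⟨rfl, rfl, rfl⟩

/-- For an odd prime `q` the curve `32a` over `ZMod q` is elliptic (`Δ = 64 ≠ 0`). -/
theorem curve32a_isElliptic {q : ℕ} [Fact q.Prime] (hq2 : q ≠ 2) : (curve32a q).IsElliptic := by
  rw [WeierstrassCurve.isElliptic_iff, (curve32a q).Δ_of_isShortNF, isUnit_iff_ne_zero]
  have h64 : (-16 * (4 * (curve32a q).a₄ ^ 3 + 27 * (curve32a q).a₆ ^ 2) : ZMod q) = 2 ^ 6 := by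
    simp only [curve32a]; ring
  rw [h64]
  exact pow_ne_zero _ (Ring.two_ne_zero (show ringChar (ZMod q) ≠ 2 by rw [ZMod.ringChar_zmod_n]; exact hq2))

/-- The defining congruence of `nsqCubic q 0 (q − 1) 0` read in `ZMod q`: `y² ≡ x³ + (q − 1)x (mod q)` iff
`(y : ZMod q)² = ℓ(x)` for the cubic `ℓ = X³ − X` of `curve32a q`. -/
theorem nsq_congr_iff {q : ℕ} [Fact q.Prime] (x y : ℕ) :
    (y * y) % q = (x ^ 3 + 0 * x ^ 2 + (q - 1) * x + 0) % q ↔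
      ((y : ZMod q)) ^ 2 = (HasseElementary.cubic (curve32a q)).eval (x : ZMod q) := by
  have hq1 : 1 ≤ q := (Fact.out : q.Prime).one_lt.le
  have hcast : (((q - 1 : ℕ) : ZMod q)) = -1 := by
    rw [Nat.cast_sub hq1, ZMod.natCast_self, Nat.cast_one, zero_sub]
  rw [← ZMod.natCast_eq_natCast_iff', HasseElementary.eval_cubic]
  push_cast
  rw [hcast]
  simp only [curve32a]
  constructor <;> intro h <;> linear_combination h

/-- The cell's fibre count equals the tree's: `nsqCubic q 0 (q − 1) 0 x = numY (curve32a q) x`. -/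
theorem nsqCubic_eq_numY {q : ℕ} [Fact q.Prime] (x : ℕ) :
    nsqCubic q 0 (q - 1) 0 x = HasseElementary.numY (curve32a q) (x : ZMod q) := by
  unfold nsqCubic HasseElementary.numY
  refine Finset.card_bij (fun y _ => (y : ZMod q)) ?_ ?_ ?_
  · intro y hy
    simp only [Finset.mem_filter, Finset.mem_range, Finset.mem_univ, true_and] at hy ⊢
    exact (nsq_congr_iff x y).mp hy.2
  · intro y₁ hy₁ y₂ hy₂ h
    simp only [Finset.mem_filter, Finset.mem_range] at hy₁ hy₂
    have h' := (ZMod.natCast_eq_natCast_iff' y₁ y₂ q).mp h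
    rwa [Nat.mod_eq_of_lt hy₁.1, Nat.mod_eq_of_lt hy₂.1] at h'
  · intro z hz
    simp only [Finset.mem_filter, Finset.mem_univ, true_and] at hz
    refine ⟨z.val, ?_, ZMod.natCast_zmod_val z⟩
    simp only [Finset.mem_filter, Finset.mem_range]
    refine ⟨ZMod.val_lt z, (nsq_congr_iff x z.val).mpr ?_⟩
    rw [ZMod.natCast_zmod_val]
    exact hz

/-- Re-indexing `Σ_{x < q} g(x mod q) = Σ_{j : ZMod q} g j`. -/
theorem sum_range_cast_eq_sum_zmod {q : ℕ} [NeZero q] (g : ZMod q → ℤ) :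
    ∑ x ∈ Finset.range q, g (x : ZMod q) = ∑ j : ZMod q, g j := by
  refine Finset.sum_nbij' (fun x : ℕ => (x : ZMod q)) (fun j : ZMod q => j.val) ?_ ?_ ?_ ?_ ?_
  · intro x _; exact Finset.mem_univ _
  · intro j _; exact Finset.mem_range.mpr (ZMod.val_lt j)
  · intro x hx
    rw [Finset.mem_range] at hx
    rw [ZMod.val_natCast, Nat.mod_eq_of_lt hx]
  · intro j _; exact ZMod.natCast_zmod_val j
  · intro x _; rfl

/-- **`a32` is the trace of Frobenius.** For an odd prime `q`, `a32 q = q + 1 − #E(ZMod q)` for `E = curve32a q`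
(points with the point at infinity). -/
theorem a32_eq_trace {q : ℕ} [Fact q.Prime] (hq2 : q ≠ 2) :
    a32 q = (q : ℤ) + 1 - (Nat.card (curve32a q).toAffine.Point : ℤ) := by
  haveI := curve32a_isElliptic hq2
  have hcard := HasseElementary.natCard_point_eq (curve32a q)
  have hsum : ∑ x ∈ Finset.range q, (nsqCubic q 0 (q - 1) 0 x : ℤ) =
      ∑ j : ZMod q, (HasseElementary.numY (curve32a q) j : ℤ) := by
    rw [← sum_range_cast_eq_sum_zmod (fun j => (HasseElementary.numY (curve32a q) j : ℤ))]
    refine Finset.sum_congr rfl fun x _ => ?_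
    rw [nsqCubic_eq_numY]
  unfold a32 apCubic
  rw [hsum, hcard]
  push_cast
  ring

/-- **Hasse's bound for `32a`**: `a32(q)² ≤ 4q` at every odd prime `q` (the tree's elementary Hasse theorem
`HasseElementary.trace_sq_le`, Manin/Knapp). -/
theorem a32_sq_le {q : ℕ} (hq : q.Prime) (hq2 : q ≠ 2) : a32 q * a32 q ≤ 4 * (q : ℤ) := by
  haveI : Fact q.Prime := ⟨hq⟩
  haveI := curve32a_isElliptic hq2
  have hchar : ringChar (ZMod q) ≠ 2 := by rw [ZMod.ringChar_zmod_n]; exact hq2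
  have h := HasseElementary.trace_sq_le (curve32a q) hchar
  rw [ZMod.card] at h
  rw [a32_eq_trace hq2, ← sq]
  exact h

/-- The cubic `x³ − x` has exactly the three roots `0, 1, −1` in `ZMod q`, `q` an odd prime. -/
theorem card_roots_cubic32a {q : ℕ} [Fact q.Prime] (hq2 : q ≠ 2) :
    (Finset.univ.filter fun j : ZMod q => (HasseElementary.cubic (curve32a q)).eval j = 0).card = 3 := by
  have h2 : (2 : ZMod q) ≠ 0 :=
    Ring.two_ne_zero (show ringChar (ZMod q) ≠ 2 by rw [ZMod.ringChar_zmod_n]; exact hq2)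
  have hset : (Finset.univ.filter fun j : ZMod q => (HasseElementary.cubic (curve32a q)).eval j = 0) =
      {0, 1, -1} := by
    ext j
    simp only [Finset.mem_filter, Finset.mem_univ, true_and, Finset.mem_insert, Finset.mem_singleton,
      HasseElementary.eval_cubic, curve32a]
    constructor
    · intro h
      have h' : j * (j - 1) * (j + 1) = 0 := by linear_combination h
      rcases mul_eq_zero.mp h' with h'' | h''
      · rcases mul_eq_zero.mp h'' with h3 | h3
        · exact Or.inl h3
        · exact Or.inr (Or.inl (sub_eq_zero.mp h3))
      · exact Or.inr (Or.inr (eq_neg_of_add_eq_zero_left h''))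
    · rintro (rfl | rfl | rfl) <;> ring
  rw [hset]
  have h01 : (0 : ZMod q) ≠ 1 := zero_ne_one
  have h0m : (0 : ZMod q) ≠ -1 := by
    intro h; apply h01; linear_combination -h
  have h1m : (1 : ZMod q) ≠ -1 := by
    intro h; apply h2; linear_combination h
  rw [Finset.card_insert_of_notMem (by simp [h01, h0m]), Finset.card_insert_of_notMem (by simp [h1m]),
    Finset.card_singleton]

/-- Each fibre count is `1` at a root of the cubic and even (`0` or `2`) elsewhere. -/
theorem numY_mod_two {q : ℕ} [Fact q.Prime] (hq2 : q ≠ 2) (j : ZMod q) :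
    HasseElementary.numY (curve32a q) j % 2 =
      if (HasseElementary.cubic (curve32a q)).eval j = 0 then 1 else 0 := by
  haveI := curve32a_isElliptic hq2
  have hchar : ringChar (ZMod q) ≠ 2 := by rw [ZMod.ringChar_zmod_n]; exact hq2
  by_cases h0 : (HasseElementary.cubic (curve32a q)).eval j = 0
  · rw [if_pos h0, HasseElementary.numY_of_eval_eq_zero (curve32a q) hchar h0]
  · rw [if_neg h0]
    by_cases hs : IsSquare ((HasseElementary.cubic (curve32a q)).eval j)
    · rw [HasseElementary.numY_of_isSquare (curve32a q) hchar h0 hs]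
    · rw [HasseElementary.numY_of_not_isSquare (curve32a q) hchar hs]

/-- **`a32(q)` is even** at every odd prime `q`. -/
theorem a32_even {q : ℕ} (hq : q.Prime) (hq2 : q ≠ 2) : a32 q % 2 = 0 := by
  haveI : Fact q.Prime := ⟨hq⟩
  haveI := curve32a_isElliptic hq2
  have hS : (∑ j : ZMod q, HasseElementary.numY (curve32a q) j) % 2 = 1 := by
    rw [Finset.sum_nat_mod, Finset.sum_congr rfl fun j _ => numY_mod_two hq2 j, Finset.sum_boole,
      card_roots_cubic32a hq2]
    norm_num
  have hq_odd : q % 2 = 1 := Nat.odd_iff.mp (hq.odd_of_ne_two hq2)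
  have hcard := HasseElementary.natCard_point_eq (curve32a q)
  have ha := a32_eq_trace hq2
  rw [hcard] at ha
  push_cast at ha
  have hSz : (∑ j : ZMod q, (HasseElementary.numY (curve32a q) j : ℤ)) % 2 = 1 := by
    exact_mod_cast hS
  omega

/-- **`a_q(32a) ∈ bs04Allowed q` for every odd prime `q`** — the arithmetic hypothesis `hA` of
`CONJ_LR32_L1_of_exists`, discharged (evenness + Hasse). -/
theorem a32_mem_bs04Allowed (q : ℕ) (hq : q.Prime) (hq2 : q ≠ 2) : a32 q ∈ bs04Allowed q :=
  (mem_bs04Allowed_iff q (a32 q)).mpr (Or.inl ⟨a32_even hq hq2, a32_sq_le hq hq2⟩)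

/-- **`CONJ_LR32_L1` is exactly its level-raising existence clause** (referee ref-g35 / lead R2, unconditional):
for every model `M`, `CONJ_LR32_L1 M` holds iff for all primes `ℓ ≥ 3`, `n ≥ 11`, `n ≠ ℓ` with Ribet's condition
`LevelRaise a32 ℓ n` some newform of level `2⁵ℓ` is `CongruentTo … a32` modulo a prime above `n`. (In print, for the
intended model: [Rib90b, Thm 1] / [DT94, Thm A] give the existence; the typed conjecture asserts nothing more.) -/
theorem CONJ_LR32_L1_iff_exists (M : NewformModel) :
    CONJ_LR32_L1 M ↔
      ∀ ℓ n : ℕ, ℓ.Prime → 3 ≤ ℓ → n.Prime → 11 ≤ n → n ≠ ℓ → LevelRaise a32 ℓ n →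
        ∃ f : M.Form (2 ^ 5 * ℓ), CongruentTo M f n a32 := by
  constructor
  · intro h ℓ n hℓ h3 hn h11 hnℓ hLR
    obtain ⟨f, hf, -⟩ := h ℓ n hℓ h3 hn h11 hnℓ hLR
    exact ⟨f, hf⟩
  · exact CONJ_LR32_L1_of_exists M (fun q hq hq2 => a32_mem_bs04Allowed q hq hq2)

end Summit.Ventures.AbcSig.Conjectures
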